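import Summits.FinalStateConjecture.FinalStateConjecture.Theorems.TameCensorship.Negative.GenericityModel
import Mathlib.Analysis.SpecialFunctions.Trigonometric.ArctanDeriv
import Mathlib.Analysis.Real.Pi.Bounds

/-!
# Christodoulou's curve-genericity is not closed under conjunction — part 2: the trap (negative-side support for crux `TameCensorship`, `stmt-FinalStateConjecture-10047`)

The crux `TameCensorship` of route `PhotonSphereChannels` bundles weak cosmic censorship, a
dynamical third law and a-priori tameness into ONE Christodoulou-generic property
(`InitialDataSet.IsChristodoulouGeneric … 1`, `Literature/Geometry/Lorentzian/Genericity.lean`),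
and the route's two-layer plan foresees gluing it from the three separately generic parts. This
file proves that such a glue step is not available as pure logic:

* `isChristodoulouGeneric_and_fails` — on the data space of the Minkowski slice `ℝ³` (all smooth
  `(h, k)`, admissible class `univ`) there are properties `P`, `Q`, each Christodoulou-generic with
  codimension `≥ 1` in curve form, whose conjunction is NOT;
* `not_isChristodoulouGeneric_and_closed` — hence the schematic glue lemma
  "`P`, `Q` generic ⇒ `P ∧ Q` generic" is false for this genericity notion. A proof of the crux
  from separately generic WCC / third law / tameness must produce ONE admissible curve escaping all
  three exceptional sets at once (or use an intersection-stable genericity, which the summit does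
  not).

Model (data space, observable `Φ(D) = (k(0)(e, e), k(e)(e, e)) ∈ ℝ²` and families from
`GenericityModel.lean`): exceptional set of `P` = origin and closed upper semicircles of radii
`1/(n+1)`, of `Q` = open lower semicircles. Each is escaped from every point by a smooth injective
family (radial, with the bounded reparametrisation `θ_n = arctan / (4(n+2))` that never reaches a
neighbouring circle, `no_circle_rescale`; or parabolic `(t, -t²)` from the origin), but their union
contains whole circles shrinking to `Φ(trivialData) = 0`, so every smooth family through the trivial
datum meets it at a nonzero parameter (intermediate value theorem on the squared radius of the
observable, `not_isChristodoulouGeneric_P_and_Q`).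
-/

noncomputable section

open Bundle TopologicalSpace Manifold Set
open scoped ContDiff Topology InnerProductSpace RealInnerProductSpace

namespace Summit.FinalStateConjecture.FinalStateConjecture.Theorems.TameCensorship.Negative

open Literature.Geometry.Lorentzian

/-! ### The trap: concentric circles in the observable plane -/

/-- Radius `1/(n+1)` of the `n`-th circle. -/
def rad (n : ℕ) : ℝ := 1 / ((n : ℝ) + 1)

/-- The radii are positive. -/
theorem rad_pos (n : ℕ) : 0 < rad n := by unfold rad; positivity

/-- The radii are at most `1`. -/
theorem rad_le_one (n : ℕ) : rad n ≤ 1 := by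
  unfold rad
  rw [div_le_one (by positivity)]
  linarith [n.cast_nonneg (α := ℝ)]

/-- The `n`-th circle `{u² + v² = rad n ²}` in the observable plane. -/
def circle (n : ℕ) : Set (ℝ × ℝ) := {q | q.1 ^ 2 + q.2 ^ 2 = rad n ^ 2}

/-- Membership in the `n`-th circle. -/
theorem mem_circle {n : ℕ} {q : ℝ × ℝ} : q ∈ circle n ↔ q.1 ^ 2 + q.2 ^ 2 = rad n ^ 2 := Iff.rfl

/-- Exceptional set of `P`: the origin and the closed upper semicircles. -/
def setA : Set (ℝ × ℝ) := {q | q = 0 ∨ ∃ n, q ∈ circle n ∧ 0 ≤ q.2}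

/-- Exceptional set of `Q`: the open lower semicircles. -/
def setB : Set (ℝ × ℝ) := {q | ∃ n, q ∈ circle n ∧ q.2 < 0}

/-- The good set of `P`: the observable avoids the origin and the upper semicircles. -/
def goodP : Set SliceData := {D | Φ D ∉ setA}

/-- The good set of `Q`: the observable avoids the lower semicircles. -/
def goodQ : Set SliceData := {D | Φ D ∉ setB}

/-- Membership in the good set of `P`. -/
theorem mem_goodP {D : SliceData} : D ∈ goodP ↔ Φ D ∉ setA := Iff.rfl

/-- Membership in the good set of `Q`. -/
theorem mem_goodQ {D : SliceData} : D ∈ goodQ ↔ Φ D ∉ setB := Iff.rfl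

/-- Key arithmetic: a nonzero relative rescaling by less than half the relative gap never lands
on another circle. -/
theorem no_circle_rescale {n m : ℕ} {θ : ℝ} (hθ : |θ| < 1 / (2 * ((n : ℝ) + 2)))
    (hθ0 : θ ≠ 0) : ((m : ℝ) + 1) * (1 + θ) ≠ (n : ℝ) + 1 := by
  intro h
  have hn : (0 : ℝ) ≤ n := n.cast_nonneg
  have hq : 0 < 2 * ((n : ℝ) + 2) := by positivity
  have hθ' : |θ| * (2 * ((n : ℝ) + 2)) < 1 := (lt_div_iff₀ hq).1 hθ
  have habs : 0 ≤ |θ| := abs_nonneg θ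
  have e0 : |θ| * (2 * ((n : ℝ) + 2)) = (n : ℝ) * |θ| * 2 + 4 * |θ| := by ring
  have hnθ : (n : ℝ) * |θ| * 2 < 1 := by nlinarith
  have hθ4 : 4 * |θ| < 1 := by nlinarith
  have hθle : θ ≤ |θ| := le_abs_self θ
  have hθge : -|θ| ≤ θ := neg_abs_le θ
  have hpos : 0 ≤ 1 + θ := by linarith
  rcases lt_trichotomy m n with hm | heq | hm
  · have hm' : (m : ℝ) + 1 ≤ n := by exact_mod_cast (show m + 1 ≤ n from hm)
    have h1 : ((m : ℝ) + 1) * (1 + θ) ≤ n * (1 + θ) := mul_le_mul_of_nonneg_right hm' hpos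
    have e1 : (n : ℝ) * (1 + θ) = n + n * θ := by ring
    have h2 : (n : ℝ) * θ ≤ n * |θ| := mul_le_mul_of_nonneg_left hθle hn
    linarith
  · subst heq
    have e2 : ((m : ℝ) + 1) * (1 + θ) = (m + 1) + (m + 1) * θ := by ring
    have h3 : ((m : ℝ) + 1) * θ = 0 := by linarith
    rcases mul_eq_zero.1 h3 with h4 | h4
    · have : (0 : ℝ) < (m : ℝ) + 1 := by positivity
      linarith
    · exact hθ0 h4
  · have hm' : (n : ℝ) + 2 ≤ (m : ℝ) + 1 := by exact_mod_cast (show n + 2 ≤ m + 1 by omega)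
    have h1 : ((n : ℝ) + 2) * (1 + θ) ≤ ((m : ℝ) + 1) * (1 + θ) :=
      mul_le_mul_of_nonneg_right hm' hpos
    have e3 : ((n : ℝ) + 2) * (1 + θ) = n + 2 + (n + 2) * θ := by ring
    have h4 : ((n : ℝ) + 2) * (-|θ|) ≤ (n + 2) * θ :=
      mul_le_mul_of_nonneg_left hθge (by positivity)
    have e4 : ((n : ℝ) + 2) * (-|θ|) = -((n : ℝ) * |θ|) - 2 * |θ| := by ring
    linarith

/-- The bounded, injective, smooth reparametrisation `θ_n(t) = arctan t / (4 (n + 2))`. -/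
def θf (n : ℕ) (t : ℝ) : ℝ := Real.arctan t / (4 * ((n : ℝ) + 2))

/-- `θ_n(0) = 0`. -/
theorem θf_zero (n : ℕ) : θf n 0 = 0 := by simp [θf]

/-- `|θ_n| < 1 / (2 (n + 2))` (half the relative gap to the neighbouring circles). -/
theorem abs_θf_lt (n : ℕ) (t : ℝ) : |θf n t| < 1 / (2 * ((n : ℝ) + 2)) := by
  have h4 : 0 < 4 * ((n : ℝ) + 2) := by positivity
  have ha : |Real.arctan t| < 2 := by
    rw [abs_lt]
    constructor
    · linarith [Real.neg_pi_div_two_lt_arctan t, Real.pi_lt_four]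
    · linarith [Real.arctan_lt_pi_div_two t, Real.pi_lt_four]
  rw [θf, abs_div, abs_of_pos h4, div_lt_div_iff₀ h4 (by positivity)]
  nlinarith

/-- `θ_n(t) = 0` only at `t = 0`. -/
theorem θf_eq_zero_iff (n : ℕ) (t : ℝ) : θf n t = 0 ↔ t = 0 := by
  have h4 : (4 * ((n : ℝ) + 2)) ≠ 0 := by positivity
  rw [θf, div_eq_zero_iff, or_iff_left h4, Real.arctan_eq_zero_iff]

/-- `θ_n` is injective. -/
theorem θf_injective (n : ℕ) : Function.Injective (θf n) := by
  intro s t h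
  have h4 : (4 * ((n : ℝ) + 2)) ≠ 0 := by positivity
  have : Real.arctan s = Real.arctan t := by
    simpa [θf, div_left_inj' h4] using h
  exact Real.arctan_injective this

/-- `θ_n` is smooth. -/
theorem contDiff_θf (n : ℕ) : ContDiff ℝ ∞ (θf n) :=
  Real.contDiff_arctan.div_const _

/-- `1 + θ_n(t) > 0`. -/
theorem one_add_θf_pos (n : ℕ) (t : ℝ) : 0 < 1 + θf n t := by
  have h := (abs_lt.1 (abs_θf_lt n t)).1
  have : 1 / (2 * ((n : ℝ) + 2)) ≤ 1 / 4 := by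
    rw [div_le_div_iff₀ (by positivity) (by norm_num)]
    linarith [n.cast_nonneg (α := ℝ)]
  linarith

/-- **Radial escape.** Through a datum whose observable lies on the `n`-th circle passes a
smooth injective family whose other members avoid the origin and every circle. -/
theorem radial_escape (D : SliceData) {n : ℕ} (hn : Φ D ∈ circle n) :
    ∃ F : EuclideanSpace ℝ (Fin 1) → SliceData, InitialDataSet.IsSmoothDataFamily 1 F ∧
      F 0 = D ∧ Function.Injective F ∧ ∀ c ≠ 0, F c ∈ goodP ∧ F c ∈ goodQ := by
  set u := (Φ D).1 with hu
  set v := (Φ D).2 with hv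
  have hrad : u ^ 2 + v ^ 2 = rad n ^ 2 := hn
  have huv : u ≠ 0 ∨ v ≠ 0 := by
    by_contra h
    push Not at h
    rw [h.1, h.2] at hrad
    have := rad_pos n
    nlinarith
  refine ⟨fam D (fun t ↦ u * θf n t) (fun t ↦ v * θf n t),
    isSmoothDataFamily_fam D (contDiff_const.mul (contDiff_θf n))
      (contDiff_const.mul (contDiff_θf n)),
    fam_zero D _ _ (by rw [θf_zero, mul_zero]) (by rw [θf_zero, mul_zero]), ?_, ?_⟩
  · intro c c' h
    have h₀ := congrArg (fun D : SliceData ↦ D.k p₀ e e) h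
    have h₁ := congrArg (fun D : SliceData ↦ D.k p₁ e e) h
    simp only [fam_k_p₀, fam_k_p₁, add_right_inj] at h₀ h₁
    apply euclid1_ext
    apply θf_injective n
    rcases huv with hne | hne
    · exact mul_left_cancel₀ hne h₀
    · exact mul_left_cancel₀ hne h₁
  · intro c hc
    have hc0 : c 0 ≠ 0 := euclid1_ne_zero hc
    have hθ0 : θf n (c 0) ≠ 0 := fun h ↦ hc0 ((θf_eq_zero_iff n _).1 h)
    have hpos := one_add_θf_pos n (c 0)
    have hΦ : Φ (fam D (fun t ↦ u * θf n t) (fun t ↦ v * θf n t) c) =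
        (u * (1 + θf n (c 0)), v * (1 + θf n (c 0))) := by
      rw [Φ_fam, ← hu, ← hv]; ext <;> ring
    -- not the origin
    have hne : Φ (fam D (fun t ↦ u * θf n t) (fun t ↦ v * θf n t) c) ≠ 0 := by
      rw [hΦ]
      intro h
      have h1 : u * (1 + θf n (c 0)) = 0 := congrArg Prod.fst h
      have h2 : v * (1 + θf n (c 0)) = 0 := congrArg Prod.snd h
      rcases huv with hne | hne
      · exact hne (by simpa [hpos.ne'] using h1)
      · exact hne (by simpa [hpos.ne'] using h2)
    -- on no circle
    have hnc : ∀ m, Φ (fam D (fun t ↦ u * θf n t) (fun t ↦ v * θf n t) c) ∉ circle m := by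
      intro m hm
      rw [hΦ, mem_circle] at hm
      simp only at hm
      have hsq : ((1 + θf n (c 0)) * rad n) ^ 2 = rad m ^ 2 := by
        rw [← hm, mul_pow, ← hrad]; ring
      have heq : (1 + θf n (c 0)) * rad n = rad m := by
        have := (sq_eq_sq₀ (mul_nonneg hpos.le (rad_pos n).le)
          (rad_pos m).le).1 hsq
        exact this
      apply no_circle_rescale (m := m) (abs_θf_lt n (c 0)) hθ0
      unfold rad at heq
      field_simp at heq
      linarith
    exact ⟨fun h ↦ h.elim hne fun ⟨m, hm, _⟩ ↦ hnc m hm, fun ⟨m, hm, _⟩ ↦ hnc m hm⟩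

/-- **Escape from the origin along the parabola `(t, -t²)`**, which meets no upper semicircle. -/
theorem origin_escape (D : SliceData) (h0 : Φ D = 0) :
    ∃ F : EuclideanSpace ℝ (Fin 1) → SliceData, InitialDataSet.IsSmoothDataFamily 1 F ∧
      F 0 = D ∧ Function.Injective F ∧ ∀ c ≠ 0, F c ∈ goodP := by
  refine ⟨fam D (fun t ↦ t) (fun t ↦ -(t * t)),
    isSmoothDataFamily_fam D contDiff_id (contDiff_id.mul contDiff_id).neg,
    fam_zero D _ _ rfl (by norm_num), ?_, ?_⟩
  · intro c c' h
    have h₀ := congrArg (fun D : SliceData ↦ D.k p₀ e e) h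
    simp only [fam_k_p₀, add_right_inj] at h₀
    exact euclid1_ext h₀
  · intro c hc
    have hc0 : c 0 ≠ 0 := euclid1_ne_zero hc
    have hΦ : Φ (fam D (fun t ↦ t) (fun t ↦ -(t * t)) c) = (c 0, -(c 0 * c 0)) := by
      rw [Φ_fam, h0]; simp
    intro hA
    rw [hΦ] at hA
    rcases hA with h | ⟨m, -, hm⟩
    · exact hc0 (congrArg Prod.fst h)
    · simp only at hm
      have : 0 < c 0 * c 0 := mul_self_pos.2 hc0
      linarith

/-- `P` is Christodoulou-generic (codimension `≥ 1`, curve form) in all slice data. -/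
theorem isChristodoulouGeneric_P :
    InitialDataSet.IsChristodoulouGeneric (Set.univ : Set SliceData) (· ∈ goodP) 1 := by
  rintro D ⟨-, hD⟩
  simp only [mem_goodP, not_not] at hD
  rcases hD with h0 | ⟨n, hn, -⟩
  · obtain ⟨F, hF, h0', hinj, hgood⟩ := origin_escape D h0
    exact ⟨F, hF, h0', hinj, fun _ ↦ trivial, fun c hc hmem ↦ hmem.2 (hgood c hc)⟩
  · obtain ⟨F, hF, h0', hinj, hgood⟩ := radial_escape D hn
    exact ⟨F, hF, h0', hinj, fun _ ↦ trivial, fun c hc hmem ↦ hmem.2 (hgood c hc).1⟩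

/-- `Q` is Christodoulou-generic (codimension `≥ 1`, curve form) in all slice data. -/
theorem isChristodoulouGeneric_Q :
    InitialDataSet.IsChristodoulouGeneric (Set.univ : Set SliceData) (· ∈ goodQ) 1 := by
  rintro D ⟨-, hD⟩
  simp only [mem_goodQ, not_not] at hD
  obtain ⟨n, hn, -⟩ := hD
  obtain ⟨F, hF, h0', hinj, hgood⟩ := radial_escape D hn
  exact ⟨F, hF, h0', hinj, fun _ ↦ trivial, fun c hc hmem ↦ hmem.2 (hgood c hc).2⟩

/-- The observable of the trivial (Minkowski) datum is the origin. -/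
theorem Φ_trivialData : Φ trivialData = 0 := by
  simp [Φ]

/-- **The trap.** `P ∧ Q` is NOT Christodoulou-generic: every smooth injective family through
the trivial datum (observable at the origin) meets a circle at a nonzero parameter, by the
intermediate value theorem applied to the squared radius of the observable. -/
theorem not_isChristodoulouGeneric_P_and_Q :
    ¬ InitialDataSet.IsChristodoulouGeneric (Set.univ : Set SliceData)
      (fun D ↦ D ∈ goodP ∧ D ∈ goodQ) 1 := by
  intro hgen
  have hex : trivialData ∈ {d ∈ (Set.univ : Set SliceData) | ¬ (d ∈ goodP ∧ d ∈ goodQ)} :=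
    ⟨trivial, fun h ↦ h.1 (Or.inl Φ_trivialData)⟩
  obtain ⟨F, hF, hF0, -, -, hexc⟩ := hgen trivialData hex
  -- the good members avoid `A ∪ B`
  have hgood : ∀ c ≠ 0, Φ (F c) ∉ setA ∧ Φ (F c) ∉ setB := fun c hc ↦ by
    have h := hexc c hc
    simp only [Set.mem_setOf_eq, Set.mem_univ, true_and, not_not] at h
    exact h
  -- the straight parameter curve `t ↦ t e₁`
  set e₁ : EuclideanSpace ℝ (Fin 1) := EuclideanSpace.single 0 1 with he₁
  set ι : ℝ → EuclideanSpace ℝ (Fin 1) := fun t ↦ t • e₁ with hι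
  have hι0 : ∀ t, ι t 0 = t := fun t ↦ by simp [hι, he₁]
  have hιne : ∀ t ≠ 0, ι t ≠ 0 := fun t ht h ↦ ht (by rw [← hι0 t, h]; rfl)
  have hιz : ι 0 = 0 := by simp [hι]
  have hιs : ContMDiff 𝓘(ℝ, ℝ) 𝓘(ℝ, EuclideanSpace ℝ (Fin 1)) ∞ ι :=
    (contDiff_id.smul contDiff_const).contMDiff
  -- squared radius of the observable along the curve
  set f : ℝ → ℝ := fun t ↦ ((F (ι t)).k p₀ e e) ^ 2 + ((F (ι t)).k p₁ e e) ^ 2 with hf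
  have hfc : Continuous f :=
    ((continuous_k_apply hF hιs p₀ e e).pow 2).add ((continuous_k_apply hF hιs p₁ e e).pow 2)
  have hf0 : f 0 = 0 := by
    simp only [hf, hιz, hF0]
    simp
  have hf1 : 0 < f 1 := by
    have hA := (hgood (ι 1) (hιne 1 one_ne_zero)).1
    have hne : Φ (F (ι 1)) ≠ 0 := fun h ↦ hA (Or.inl h)
    have : (Φ (F (ι 1))).1 ≠ 0 ∨ (Φ (F (ι 1))).2 ≠ 0 := by
      by_contra h
      push Not at h
      exact hne (Prod.ext h.1 h.2)
    simp only [hf, Φ] at this ⊢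
    rcases this with h | h
    · have := pow_pos (abs_pos.2 h) 2; rw [pow_abs] at this  -- hmm
      positivity
    · positivity
  obtain ⟨n, hn⟩ := exists_nat_one_div_lt hf1
  have hn' : rad n ^ 2 ≤ f 1 := by
    have h1 : rad n ^ 2 ≤ rad n := by
      rw [sq]; exact mul_le_of_le_one_left (rad_pos n).le (rad_le_one n)
    exact h1.trans (le_of_lt hn)
  obtain ⟨t, ht, hft⟩ :=
    intermediate_value_Icc zero_le_one hfc.continuousOn ⟨by rw [hf0]; positivity, hn'⟩
  have ht0 : t ≠ 0 := by
    rintro rfl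
    rw [hf0] at hft
    exact (pow_pos (rad_pos n) 2).ne hft
  have hcirc : Φ (F (ι t)) ∈ circle n := hft
  rcases le_or_gt 0 (Φ (F (ι t))).2 with h | h
  · exact (hgood (ι t) (hιne t ht0)).1 (Or.inr ⟨n, hcirc, h⟩)
  · exact (hgood (ι t) (hιne t ht0)).2 ⟨n, hcirc, h⟩

/-- **Christodoulou's curve-genericity (`IsChristodoulouGeneric … 1`) is not closed under
conjunction**: on the data space of the Minkowski slice there are properties `P`, `Q`, each
generic in the admissible class `univ`, whose conjunction is not. -/
theorem isChristodoulouGeneric_and_fails :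
    ∃ (P Q : SliceData → Prop),
      InitialDataSet.IsChristodoulouGeneric Set.univ P 1 ∧
      InitialDataSet.IsChristodoulouGeneric Set.univ Q 1 ∧
      ¬ InitialDataSet.IsChristodoulouGeneric Set.univ (fun D ↦ P D ∧ Q D) 1 :=
  ⟨(· ∈ goodP), (· ∈ goodQ), isChristodoulouGeneric_P, isChristodoulouGeneric_Q,
    not_isChristodoulouGeneric_P_and_Q⟩


/-- **The glue lemma is false.** Christodoulou-genericity (codimension `≥ 1`, curve form) of two
properties does not imply that of their conjunction — already on the Minkowski slice with the full
data space as admissible class. -/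
theorem not_isChristodoulouGeneric_and_closed :
    ¬ ∀ (𝓓 : Set SliceData) (P Q : SliceData → Prop),
      InitialDataSet.IsChristodoulouGeneric 𝓓 P 1 → InitialDataSet.IsChristodoulouGeneric 𝓓 Q 1 →
        InitialDataSet.IsChristodoulouGeneric 𝓓 (fun D ↦ P D ∧ Q D) 1 :=
  fun h ↦ not_isChristodoulouGeneric_P_and_Q (h _ _ _ isChristodoulouGeneric_P isChristodoulouGeneric_Q)

end Summit.FinalStateConjecture.FinalStateConjecture.Theorems.TameCensorship.Negative

end
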